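import Mathlib
import Literature.NumberTheory.EllipticCurves.Smith2016.CongruentNumberGenusDeterminantRowSixBlocks
import Literature.NumberTheory.EllipticCurves.Smith2016.CongruentNumberGenusDeterminantReciprocityForest

/-!
# Smith 2016, Theorem 2.2 row 5(b) in forest form (every `k`): `det M_{5b} = Σ_j t_j (adj(N₁)_{(inl j)(inl j)} + adj(N₁)_{(inr j)(inr j)})`, evaluated

A. Smith, *The congruent numbers have positive natural density*, arXiv:1603.08479 [Smith2016CongruentDensity],
Table 2 row 5(b) (source `cnc.tex` l. 88–93): for `n ≡ 5 (mod 8)`,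
`ℒ_{5b}(n) = Σ_{d₀d₁ | n, d₀ ≡ 7 (8), d₁ ≡ 3 (8)} g(d₀)g(d₁)ℒ(n/d₀d₁)` and
`M_{5b} = [[A + Aᵀ, Aᵀ, 0],[A, D_z, y],[0, yᵀ, 0]]` (`(2r+1) × (2r+1)`) — Smith's `M₁` bordered by the column
`(0; y)` supported on the `D_z` block; Thm. 2.2: `ℒ_{5b}(n) = det M_{5b}`; §2.2 (source `cnc2.tex` l. 44–62): the
"linearization" `N(A, z, w)` and "`det N(A, z, y) = Σ_{S} det O(A, z, y)[S] det O(A, y, y)[S′]`".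
Here `y = t = ((−1/pᵢ)₊)`, `z = ((2/pᵢ)₊)`, `A = legendreMatrix p`.

Over `𝔽₂`, `det [[M₁, b],[bᵀ, 0]] = bᵀ adj(M₁) b`; this file evaluates it for `b = (0; t)` and every `k`:
* `border_adjugate_transport_inr` — `E = [[I,I],[0,I]]` takes `M₁` to `N₁ = bigN a univ z z z` and `(0; w)` to `(w; w)`,
  so `(0;w)ᵀ adj(M₁) (0;w) = Σ_j w_j (adj(N₁)_{(inl j)(inl j)} + adj(N₁)_{(inr j)(inr j)})`;
* `border_adjugate_fiveB_eq_sum_powerset` — by the mark- and root-copy cofactor formulas: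
  `= Σ_{B ⊆ [k]} (t_B q_z(A^B) + z_B q_t(A^B)) · e₁([k]∖B)` (`e₁ = setExp(fwt a z z z)`, Smith's `det M₁[S′]`); the
  bracket is Smith's `det N(A, z, t)[B]`;
* `bracket_eq_sum_genusWeight` — **the bracket in genus class numbers**: `t_B q_z(A^B) + z_B q_t(A^B) =
  Σ_{S ⊆ B} [d_S ≡ 3 (8)] g(d_S) · [d_{B∖S} ≡ 3 (4)] g(d_{B∖S})` (reciprocity lemma + doubling identity of
  `CongruentNumberGenusDeterminantReciprocityForest`, and the dictionary: the bracket vanishes for `d_B ≡ 3 (4)` and is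
  `z_B q_t(A^B)` for `d_B ≡ 1 (4)`);
* `border_adjugate_fiveB_eq_sum_genusWeight` — for `∏ pᵢ ≡ 5 (mod 8)`:
  `(0;t)ᵀ adj(M₁) (0;t) = Σ_{B ⊆ [k]} Σ_{S ⊆ B} [d_S ≡ 3 (8)] g(d_S) · [d_{B∖S} ≡ 7 (8)] g(d_{B∖S}) · ℒ(d_{[k]∖B})` —
  Smith's `ℒ_{5b}(n)` over index blocks (`ℒ(m) = Σ_{D ∈ decompositions m} ∏ [d ≡ 1 (8)] g(d)`).
The identification with `Σ₂'(n) − Σ₁(n)` and the `2`-Selmer consequence are in `CongruentNumberGenusDeterminantRowFiveB`.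
-/

namespace Literature.NumberTheory.EllipticCurves.Smith2016

open _root_.Matrix Finset Literature.LinearAlgebra.Matrix Literature.Combinatorics.Enumerative
open Literature.NumberTheory.EllipticCurves.HeathBrown1994
open Literature.NumberTheory.EllipticCurves.TianYuanZhang2017
open Literature.NumberTheory.EllipticCurves.HeathBrown1994.Families (legendreMatrix_apply_of_ne legendreMatrix_apply_self)
open Literature.NumberTheory.EllipticCurves.MonskySelmerParity

section Transport

variable {V : Type*} [Fintype V] [DecidableEq V]

/-- **Transport of a border in the `D_z` block**: `(0;w)ᵀ adj(M₁) (0;w) = (w;w)ᵀ adj(E M₁ Eᵀ) (w;w)` for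
`M₁ = [[A + Aᵀ, Aᵀ],[A, D]]`, `E = [[I, I],[0, I]]` (`E (w; w) = (0; w)`, `E² = I`, `adj E = E`), and
`E M₁ Eᵀ = [[D, Aᵀ + D],[A + D, D]]`. [cite: Smith2016CongruentDensity, §2.2 (source cnc2.tex l. 44–52: the border (0; w) of M₁ and the matrix N(A, z, w))] [cite: HornJohnson2013, §0.8.2 (adj(AB) = adj(B) adj(A))] -/
theorem border_adjugate_transport_inr (A D : Matrix V V (ZMod 2)) (w : V → ZMod 2) :
    Sum.elim (0 : V → ZMod 2) w ⬝ᵥ ((fromBlocks (A + Aᵀ) Aᵀ A D).adjugate *ᵥ Sum.elim (0 : V → ZMod 2) w) =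
      Sum.elim w w ⬝ᵥ ((fromBlocks D (Aᵀ + D) (A + D) D).adjugate *ᵥ Sum.elim w w) := by
  have hEt : (fromBlocks (1 : Matrix V V (ZMod 2)) (1 : Matrix V V (ZMod 2)) (0 : Matrix V V (ZMod 2)) (1 : Matrix V V (ZMod 2)))ᵀ =
      fromBlocks (1 : Matrix V V (ZMod 2)) (0 : Matrix V V (ZMod 2)) (1 : Matrix V V (ZMod 2)) (1 : Matrix V V (ZMod 2)) := by
    rw [fromBlocks_transpose, transpose_one, transpose_zero]
  have hconj := conj_fromBlocks_add_transpose A D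
  rw [← hEt] at hconj
  have hEu : fromBlocks (1 : Matrix V V (ZMod 2)) (1 : Matrix V V (ZMod 2)) (0 : Matrix V V (ZMod 2)) (1 : Matrix V V (ZMod 2)) *ᵥ
      Sum.elim w w = Sum.elim (0 : V → ZMod 2) w := by
    rw [fromBlocks_mulVec]
    ext (i | i)
    · simp only [Sum.elim_inl, Pi.add_apply, one_mulVec, Pi.zero_apply]
      exact CharTwo.add_self_eq_zero (w i)
    · simp
  rw [← hconj, adjugate_mul_distrib, adjugate_mul_distrib, ← adjugate_transpose,
    adjugate_fromBlocks_one_one_zero_one, ← mulVec_mulVec, ← mulVec_mulVec, hEu]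
  conv_rhs => rw [dotProduct_mulVec, vecMul_transpose, hEu]

/-- The bordered form `(w;w)ᵀ adj(N) (w;w)` of a symmetric matrix over `𝔽₂` is the sum of BOTH diagonal cofactors:
`Σ_j w_j (adj(N)_{(inl j)(inl j)} + adj(N)_{(inr j)(inr j)})`.
[cite: HornJohnson2013, §4.1 (quadratic form of a symmetric matrix), characteristic 2] -/
theorem border_adjugate_eq_sum_inl_add_inr {N : Matrix (V ⊕ V) (V ⊕ V) (ZMod 2)} (hN : Nᵀ = N) (w : V → ZMod 2) :
    Sum.elim w w ⬝ᵥ (N.adjugate *ᵥ Sum.elim w w) =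
      ∑ j, w j * (N.adjugate (Sum.inl j) (Sum.inl j) + N.adjugate (Sum.inr j) (Sum.inr j)) := by
  have hadj : (N.adjugate)ᵀ = N.adjugate := by rw [adjugate_transpose, hN]
  rw [dotProduct_mulVec_eq_sum_diag hadj, Fintype.sum_sum_type, ← sum_add_distrib]
  simp only [Sum.elim_inl, Sum.elim_inr]
  exact sum_congr rfl fun j _ => by ring

end Transport

variable {k : ℕ} (p : Fin k → ℕ)

section RowFiveBForest

/-- **`det M_{5b}` as a sum of mark- and root-copy cofactors** (every `k`): with `t = ((−1/pᵢ)₊)`,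
`z = ((2/pᵢ)₊)`, `M₁ = [[A + Aᵀ, Aᵀ],[A, D_z]]`, `N₁ = bigN a univ z z z`:
`(0;t)ᵀ adj(M₁) (0;t) = Σ_j t_j (adj(N₁)_{(inl j)(inl j)} + adj(N₁)_{(inr j)(inr j)})`.
[cite: Smith2016CongruentDensity, Thm. 2.2 row 5(b) / Table 2 (source cnc.tex l. 88–93) and §2.2 (cnc2.tex l. 44–62)] -/
theorem border_adjugate_fiveB_eq_sum_adjugate :
    Sum.elim (0 : Fin k → ZMod 2) (fun i => addLegendreSym (-1) (p i)) ⬝ᵥ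
        ((fromBlocks (legendreMatrix p + (legendreMatrix p)ᵀ) (legendreMatrix p)ᵀ (legendreMatrix p)
            (legendreDiagonal p 2)).adjugate *ᵥ
          Sum.elim (0 : Fin k → ZMod 2) (fun i => addLegendreSym (-1) (p i))) =
      ∑ j, addLegendreSym (-1) (p j) *
        ((bigN (fun i j => legendreMatrix p i j) univ (fun i => addLegendreSym 2 (p i))
            (fun i => addLegendreSym 2 (p i)) (fun i => addLegendreSym 2 (p i))).adjugate (Sum.inl j) (Sum.inl j) +
          (bigN (fun i j => legendreMatrix p i j) univ (fun i => addLegendreSym 2 (p i))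
            (fun i => addLegendreSym 2 (p i)) (fun i => addLegendreSym 2 (p i))).adjugate (Sum.inr j) (Sum.inr j)) := by
  have hD2 : legendreDiagonal p 2 = diagonal fun i => addLegendreSym 2 (p i) := rfl
  have hNeq : fromBlocks (legendreDiagonal p 2) ((legendreMatrix p)ᵀ + legendreDiagonal p 2)
      (legendreMatrix p + legendreDiagonal p 2) (legendreDiagonal p 2) =
      bigN (fun i j => legendreMatrix p i j) univ (fun i => addLegendreSym 2 (p i))
        (fun i => addLegendreSym 2 (p i)) (fun i => addLegendreSym 2 (p i)) := by
    rw [bigN_univ_eq_fromBlocks _ (legendreMatrix_apply_self p), hD2, transpose_add, diagonal_transpose]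
  rw [border_adjugate_transport_inr, hNeq, border_adjugate_eq_sum_inl_add_inr (bigN_transpose _ _ _ _ _)]

/-- **`det M_{5b}` as a pointed forest sum** (every `k`):
`(0;t)ᵀ adj(M₁) (0;t) = Σ_{B ⊆ [k]} (t_B · q_z(A^B) + z_B · q_t(A^B)) · Σ_{π ∈ Part([k]∖B)} ∏_{C} (1 + z_C) q_z(A^C)` —
the bracket is Smith's `det N(A, z, t)[B]`, the last factor his `det M₁(A, z)[S′]`.
[cite: Smith2016CongruentDensity, §2.2 (source cnc2.tex l. 44–62: 𝒩(A, z, w) and the second sum of (eq:7a_develop))] [cite: Chaiken1982, §2 (all minors matrix tree theorem)] -/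
theorem border_adjugate_fiveB_eq_sum_powerset :
    Sum.elim (0 : Fin k → ZMod 2) (fun i => addLegendreSym (-1) (p i)) ⬝ᵥ
        ((fromBlocks (legendreMatrix p + (legendreMatrix p)ᵀ) (legendreMatrix p)ᵀ (legendreMatrix p)
            (legendreDiagonal p 2)).adjugate *ᵥ
          Sum.elim (0 : Fin k → ZMod 2) (fun i => addLegendreSym (-1) (p i))) =
      ∑ B ∈ (univ : Finset (Fin k)).powerset,
        ((∑ i ∈ B, addLegendreSym (-1) (p i)) *
            qwt (fun i j => legendreMatrix p i j) (fun i => addLegendreSym 2 (p i)) B +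
          (∑ i ∈ B, addLegendreSym 2 (p i)) *
            qwt (fun i j => legendreMatrix p i j) (fun i => addLegendreSym (-1) (p i)) B) *
          setExp (fwt (fun i j => legendreMatrix p i j) (fun i => addLegendreSym 2 (p i))
            (fun i => addLegendreSym 2 (p i)) (fun i => addLegendreSym 2 (p i))) (univ \ B) := by
  rw [border_adjugate_fiveB_eq_sum_adjugate,
    show (∑ j, addLegendreSym (-1) (p j) *
        ((bigN (fun i j => legendreMatrix p i j) univ (fun i => addLegendreSym 2 (p i))
            (fun i => addLegendreSym 2 (p i)) (fun i => addLegendreSym 2 (p i))).adjugate (Sum.inl j) (Sum.inl j) +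
          (bigN (fun i j => legendreMatrix p i j) univ (fun i => addLegendreSym 2 (p i))
            (fun i => addLegendreSym 2 (p i)) (fun i => addLegendreSym 2 (p i))).adjugate (Sum.inr j) (Sum.inr j))) =
      ∑ j ∈ (univ : Finset (Fin k)), addLegendreSym (-1) (p j) *
        ((bigN (fun i j => legendreMatrix p i j) univ (fun i => addLegendreSym 2 (p i))
            (fun i => addLegendreSym 2 (p i)) (fun i => addLegendreSym 2 (p i))).adjugate (Sum.inl j) (Sum.inl j) +
          (bigN (fun i j => legendreMatrix p i j) univ (fun i => addLegendreSym 2 (p i))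
            (fun i => addLegendreSym 2 (p i)) (fun i => addLegendreSym 2 (p i))).adjugate (Sum.inr j) (Sum.inr j))
      from rfl,
    sum_mul_adjugate_bigN_inl_add_inr]

end RowFiveBForest

section Bracket

/-- `Σ_B zᵢ = [d_B ≡ ±3 (8)]` for every block of a tuple of odd primes. [cite: HeathBrown1994SelmerCongruentII, Appendix (Monsky), typescript p. 39 L36–L37 ("Σ vᵢ = 0 iff D ≡ ±1 (mod 8)")] -/
theorem sum_addLegendreSym_two_block_eq (hodd : ∀ i, Odd (p i)) (B : Finset (Fin k)) :
    ∑ i ∈ B, addLegendreSym 2 (p i) =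
      if (∏ i ∈ B, p i) % 8 = 3 ∨ (∏ i ∈ B, p i) % 8 = 5 then (1 : ZMod 2) else 0 :=
  HeathBrown1994.Families.sum_addLegendreSym_two_eq B p fun i _ => Nat.odd_iff.mp (hodd i)

/-- **Smith's bracket `det N(A, z, t)[B]` in genus class numbers**: for every block `B` of a tuple of distinct odd
primes, `t_B · q_z(A^B) + z_B · q_t(A^B) = Σ_{S ⊆ B} [d_S ≡ 3 (8)] g(d_S) · [d_{B∖S} ≢ 1 (4)] g(d_{B∖S})` in `𝔽₂`
(`d_∅ = 1`, so only `∅ ≠ S ≠ B` contribute).  For `d_B ≡ 3 (4)` both terms of the bracket are `[d_B ≡ 3 (8)] g(d_B)`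
and cancel; for `d_B ≡ 1 (4)` the bracket is `z_B q_t(A^B)`, which `zblock_reciprocity` expands.
[cite: Smith2016CongruentDensity, §2.2 (source cnc2.tex l. 52–62: "det N(A, z, y) is zero if n is 3 mod 4 … det N(A, z, y) = Σ_{d | n, d ≡ 3 (8)} g(d) g(n/d)")] -/
theorem bracket_eq_sum_genusWeight (hp : ∀ i, (p i).Prime) (hodd : ∀ i, Odd (p i))
    (hinj : Function.Injective p) (B : Finset (Fin k)) :
    (∑ i ∈ B, addLegendreSym (-1) (p i)) *
          qwt (fun i j => legendreMatrix p i j) (fun i => addLegendreSym 2 (p i)) B +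
        (∑ i ∈ B, addLegendreSym 2 (p i)) *
          qwt (fun i j => legendreMatrix p i j) (fun i => addLegendreSym (-1) (p i)) B =
      ∑ S ∈ B.powerset,
        (if (∏ i ∈ S, p i) % 8 = 3 then ((genusClassNumber (GenusField (∏ i ∈ S, p i)) : ℕ) : ZMod 2) else 0) *
        (if (∏ i ∈ B \ S, p i) % 4 = 1 then 0
          else ((genusClassNumber (GenusField (∏ i ∈ B \ S, p i)) : ℕ) : ZMod 2)) := by
  have hrec : ∀ i ∈ B, ∀ j ∈ B, i ≠ j →
      (fun i j => legendreMatrix p i j) i j + (fun i j => legendreMatrix p i j) j i =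
        addLegendreSym (-1) (p i) * addLegendreSym (-1) (p j) :=
    fun i _ j _ hij => legendreMatrix_add_swap p hp hodd hinj hij
  have hkey := zblock_reciprocity (fun i j => legendreMatrix p i j) (fun i => addLegendreSym (-1) (p i))
    (fun i => addLegendreSym 2 (p i)) hrec
  have h2 := blockProd_mod_two p hp hodd B
  -- the two dictionary values at `B`
  have hz := sum_addLegendreSym_two_block_eq p hodd B
  have htq := pointedWeight_neg_one_legendre_eq_genusWeight' p hp hodd hinj B
  have htz := pointedWeight_legendre_eq_genusWeight' p hp hodd hinj B
  -- rewrite the right-hand side through the dictionary, matching `hkey`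
  have hrhs : ∀ S ∈ B.powerset,
      (if (∏ i ∈ S, p i) % 8 = 3 then ((genusClassNumber (GenusField (∏ i ∈ S, p i)) : ℕ) : ZMod 2) else 0) *
        (if (∏ i ∈ B \ S, p i) % 4 = 1 then 0
          else ((genusClassNumber (GenusField (∏ i ∈ B \ S, p i)) : ℕ) : ZMod 2)) =
      ((∑ i ∈ S, addLegendreSym 2 (p i)) * ((∑ i ∈ S, addLegendreSym (-1) (p i)) *
          qwt (fun i j => legendreMatrix p i j) (fun i => addLegendreSym (-1) (p i)) S)) *
        ((∑ i ∈ B \ S, addLegendreSym (-1) (p i)) *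
          qwt (fun i j => legendreMatrix p i j) (fun i => addLegendreSym (-1) (p i)) (B \ S)) := by
    intro S _
    rw [pointedWeight_neg_one_legendre_eq_genusWeight' p hp hodd hinj S,
      pointedWeight_neg_one_legendre_eq_genusWeight' p hp hodd hinj (B \ S), sum_addLegendreSym_two_block_eq p hodd S]
    have hS2 := blockProd_mod_two p hp hodd S
    congr 1
    by_cases h3 : (∏ i ∈ S, p i) % 8 = 3
    · rw [if_pos h3, if_pos (Or.inl h3), if_neg (by omega), one_mul]
    · rw [if_neg h3]
      by_cases h5 : (∏ i ∈ S, p i) % 8 = 5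
      · rw [if_pos (Or.inr h5), if_pos (by omega), one_mul]
      · rw [if_neg (by omega), zero_mul]
  rw [sum_congr rfl hrhs, ← hkey]
  -- the left-hand side: `t_B q_z + z_B q_t = z_B (1 + t_B) q_t + t_B (q_z + z_B q_t)`, and the last bracket vanishes
  have h01 : ∀ x : ZMod 2, x = 0 ∨ x = 1 := by decide
  rcases h01 (∑ i ∈ B, addLegendreSym (-1) (p i)) with ht0 | ht1
  · -- `d_B ≡ 1 (4)`
    rw [ht0, zero_mul, zero_add, add_zero, mul_one]
  · -- `d_B ≡ 3 (4)`: both terms are `[d_B ≡ 3 (8)] g(d_B)`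
    rw [ht1] at htq htz ⊢
    rw [one_mul] at htq htz
    have h3B : ¬ (∏ i ∈ B, p i) % 4 = 1 := fun h => by
      have := sum_addLegendreSym_neg_one_block_eq p hp hodd B
      rw [ht1, if_pos h] at this
      exact one_ne_zero this
    rw [if_neg h3B] at htq
    rw [one_mul, htz, htq, hz]
    have h11 : (1 : ZMod 2) + 1 = 0 := by decide
    by_cases h3 : (∏ i ∈ B, p i) % 8 = 3
    · rw [if_pos h3, if_pos (Or.inl h3), one_mul, h11, mul_zero, zero_mul]
      exact CharTwo.add_self_eq_zero _
    · rw [if_neg h3, if_neg (by omega), zero_mul, add_zero, h11, mul_zero, zero_mul]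

end Bracket

section Assembly

/-- **`det M_{5b}` in genus class numbers** (Smith 2016, Thm. 2.2 row 5(b), every `k`): for `n = p₁⋯p_k ≡ 5 (mod 8)`,
`(0;t)ᵀ adj(M₁) (0;t) = Σ_{S ⊆ [k], d_S ≡ 3 (8)} g(d_S) · Σ_{C ⊆ [k]∖S, d_C ≡ 7 (8)} g(d_C) · ℒ(d_{[k]∖S∖C})`
— Smith's `ℒ_{5b}(n) = Σ_{d₀d₁ | n, d₀ ≡ 7 (8), d₁ ≡ 3 (8)} g(d₀)g(d₁)ℒ(n/d₀d₁)` over index blocks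
(`ℒ(m) = Σ_{D ∈ decompositions m} ∏_{d∈D} [d ≡ 1 (8)] g(d)`; `ℒ(m) = 0` unless `m ≡ 1 (8)`, which forces the residues).
[cite: Smith2016CongruentDensity, Thm. 2.2 row 5(b) / Table 2 (source cnc.tex l. 88–93) and §2.2 (cnc2.tex l. 52–62)] -/
theorem border_adjugate_fiveB_eq_sum_genusWeight (hp : ∀ i, (p i).Prime) (hodd : ∀ i, Odd (p i))
    (hinj : Function.Injective p) (h8 : (∏ i, p i) % 8 = 5) :
    Sum.elim (0 : Fin k → ZMod 2) (fun i => addLegendreSym (-1) (p i)) ⬝ᵥ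
        ((fromBlocks (legendreMatrix p + (legendreMatrix p)ᵀ) (legendreMatrix p)ᵀ (legendreMatrix p)
            (legendreDiagonal p 2)).adjugate *ᵥ
          Sum.elim (0 : Fin k → ZMod 2) (fun i => addLegendreSym (-1) (p i))) =
      ∑ S ∈ (univ : Finset (Fin k)).powerset,
        (if (∏ i ∈ S, p i) % 8 = 3 then ((genusClassNumber (GenusField (∏ i ∈ S, p i)) : ℕ) : ZMod 2) else 0) *
        ∑ C ∈ (univ \ S).powerset,
          (if (∏ i ∈ C, p i) % 8 = 7 then ((genusClassNumber (GenusField (∏ i ∈ C, p i)) : ℕ) : ZMod 2) else 0) *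
          ∑ D ∈ decompositions (∏ i ∈ (univ \ S) \ C, p i), ∏ d ∈ D,
            (if d % 8 = 1 then ((genusClassNumber (GenusField d) : ℕ) : ZMod 2) else 0) := by
  rw [border_adjugate_fiveB_eq_sum_powerset]
  -- each block term: the bracket times `ℒ(d_{[k]∖B})`, with `[d ≢ 1 (4)]` sharpened to `[d ≡ 7 (8)]`
  have hterm : ∀ B ∈ (univ : Finset (Fin k)).powerset,
      ((∑ i ∈ B, addLegendreSym (-1) (p i)) *
            qwt (fun i j => legendreMatrix p i j) (fun i => addLegendreSym 2 (p i)) B +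
          (∑ i ∈ B, addLegendreSym 2 (p i)) *
            qwt (fun i j => legendreMatrix p i j) (fun i => addLegendreSym (-1) (p i)) B) *
          setExp (fwt (fun i j => legendreMatrix p i j) (fun i => addLegendreSym 2 (p i))
            (fun i => addLegendreSym 2 (p i)) (fun i => addLegendreSym 2 (p i))) (univ \ B) =
      ∑ S ∈ B.powerset,
        (if (∏ i ∈ S, p i) % 8 = 3 then ((genusClassNumber (GenusField (∏ i ∈ S, p i)) : ℕ) : ZMod 2) else 0) *
        ((if (∏ i ∈ B \ S, p i) % 8 = 7 then ((genusClassNumber (GenusField (∏ i ∈ B \ S, p i)) : ℕ) : ZMod 2) else 0) *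
          ∑ D ∈ decompositions (∏ i ∈ univ \ B, p i), ∏ d ∈ D,
            (if d % 8 = 1 then ((genusClassNumber (GenusField d) : ℕ) : ZMod 2) else 0)) := by
    intro B _
    rw [bracket_eq_sum_genusWeight p hp hodd hinj B, setExp_fwt_legendre_eq_sum_decompositions p hp hodd hinj (univ \ B),
      sum_mul]
    refine sum_congr rfl fun S hS => ?_
    rw [mem_powerset] at hS
    have hsplitB : (∏ i ∈ univ \ B, p i) * (∏ i ∈ B, p i) = ∏ i, p i := prod_sdiff (subset_univ B)
    have hsplitS : (∏ i ∈ B \ S, p i) * (∏ i ∈ S, p i) = ∏ i ∈ B, p i := prod_sdiff hS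
    rcases em ((∏ i ∈ univ \ B, p i) % 8 = 1) with hL | hL
    · rcases em ((∏ i ∈ S, p i) % 8 = 3) with h3 | h3
      · have hB5 : (∏ i ∈ B, p i) % 8 = 5 := by
          have h := congrArg (· % 8) hsplitB
          rw [Nat.mul_mod, hL, one_mul, Nat.mod_mod] at h
          omega
        have h7 : (∏ i ∈ B \ S, p i) % 8 = 7 := by
          have h := congrArg (· % 8) hsplitS
          rw [Nat.mul_mod, h3, hB5] at h
          have hx : (∏ i ∈ B \ S, p i) % 8 < 8 := Nat.mod_lt _ (by norm_num)
          interval_cases ((∏ i ∈ B \ S, p i) % 8) <;> omega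
        rw [if_pos h3, if_neg (show ¬ (∏ i ∈ B \ S, p i) % 4 = 1 by omega), if_pos h7, mul_assoc]
      · rw [if_neg h3, zero_mul, zero_mul, zero_mul]
    · rw [sum_decompositions_rowOne_eq_zero p hL, mul_zero, mul_zero, mul_zero]
  rw [sum_congr rfl hterm, sum_powerset_sum_powerset_sub]
  refine sum_congr rfl fun S _ => ?_
  rw [mul_sum]
  refine sum_congr rfl fun C hC => ?_
  rw [mem_powerset] at hC
  have hdisj : Disjoint S C := disjoint_of_subset_right hC disjoint_sdiff
  rw [union_sdiff_cancel_left hdisj, sdiff_sdiff_left, sup_eq_union]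

end Assembly

end Literature.NumberTheory.EllipticCurves.Smith2016
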